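import Literature.MathematicalPhysics.QuantumFieldTheory.Balaban1983to89.B9Eq3119DeltaPiTower
import Literature.MathematicalPhysics.QuantumFieldTheory.Balaban1983to89.B9Eq326OperatorTowerReality

/-!
# `Balaban1983to89.B9Eq3119DeltaPiTowerReality` — T. Bałaban, *Propagators for lattice gauge theories in a background field*, Commun. Math. Phys. **99**
# (1985) 389–434 [Balaban1985BackgroundPropagators] p. 392 «For U with values in the unitary group U(N) it is a hermitian operator» for the EXTENDED form
# (3.119) p. 419 and print's operator (3.122) p. 420, at the `k`-th-step letters: **at a unitary tower print's `π_k(U) = 1 − D_U G′_k R_k(U) D*_U` is REAL, so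
# `π_kᵗ = π_k†`, the BILINEAR `Δ_{π,k}(U) = π_kᵗ Δ^η(U) π_k` (`B9Eq3119DeltaPiTower.deltaPiOfUk`, pair-typed, holomorphic along complex background families)
# IS the ADJOINT sandwich `π_k† Δ^η(U) π_k` that `B9Eq3119DeltaPiTower.laplaceAkPi` carries in its `Δ₁`-slot, and `Δ_{π,k}(U)` is symmetric** — the
# identification of the two `Δ_π` slots AT THE UNITARY CENTRE, once per chart (t4-ne9-idea-1 g99 J-Δπ-hol), = step (vi) «the k-level reality» of the OWNER
# t4-ne9-p1 g87's «Δ_π PORT» (DIAGNOSIS D-ne9p1-g87-1)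

statement-level skeleton of published theorems with citation tags; proofs where landed; nothing here is a claim about the Yang–Mills mass gap

CITATION HEADER (lean-in-tree rule).  Audit cell `pub-balaban`, sub-cell `t4`, BINDER row NE9; filed by NE9 formalisation-swarm leaf prover 05
(`b2b-balaban-t4-ne9-formalise-leaf-05`, gen 75).  CREDIT: the one-step statements and proofs are ne9-leaf-02 gen 53's (`B9Eq3119DeltaPiReality` §3); the
`k`-th-step objects are the OWNER's (`B9Eq3119DeltaPiTower`); the reality letters of the composite `Q′_k`, `R_k`, `G′_k` are `B9Eq326OperatorTowerReality`.
Source READ in the held text (`paper:balaban1985-cmp99-background-propagators`): p. 392 «hermitian operator»; p. 419 (3.119) *«⟨A, Δ_πA⟩ = ⟨A − DG′RD*A,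
Δ(A − DG′RD*A)⟩»*; p. 420 (3.122).
WHAT IS PROVED (sorry-free; proof lane — no `def`; [folklore] `*`-algebra bookkeeping BY NAME; nothing of [B9] asserted):
**`piOfUk_starW`** (any REAL Green letter `Gp`), **`btrans_piOfUk_eq_adjoint`** (`π_kᵗ = π_k†`), **`deltaPiOfUk_eq_adjoint_form`**, `deltaPiOfUk_GpOfUk_eq_adjoint_form`
(at print's `G′_k`, real by `GpOfUk_starW`), **`laplaceAkPi_eq_bilinear_slot`** ∕ **`laplaceAkPi_eq_laplaceAkPiHol`** (THE IDENTIFICATION, also against v1.1's pair-typed `laplaceAkPiHol`: `Δ̃_{a,k}(U) = laplaceALatticeK η⁻¹ R(U) R(U⁻¹) (Δ_{π,k}(U))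
(R_k(U)) (Q_k(U)) a` with the BILINEAR `Δ_{π,k}` in the `Δ₁`-slot, at a unitary tower), `laplaceAkPiHol_isSymmetric`, **`deltaPiOfUk_isSymmetric`**, `deltaPiOfUk_GpOfUk_isSymmetric`.
HONEST SCOPE.  Identities at the unitary centre only (off the unitary slice the two slots DIFFER — idea-1's J-Δπ-hol); NO estimate (step (ii), `Δ′_{π,k}`
form-smallness, is not touched); NOT NE9 (cell pub-balaban: NE9 NOT PRINTED ∕ NOT PROVED; «NE9 ⇐ the named binders»; spine PROVED 0∕9; rung (B)+1 on a
finite T⁴ — NOT infinite volume, NOT mass gap, NOT Clay; HONEST DEPENDENCY: continuum YM on T⁴ ⇐ BetaPertH ∧ nine spine estimates (0/9 proved); BetaPertH ⇐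
(D1) ∧ (D4) ∧ CAP+tail; G-an2-4 gates asym, D1 and NE2/3/4).  NEW file importing `B9Eq3119DeltaPiTower` + `B9Eq326OperatorTowerReality`; nothing modified.
Net new unproved facts: 0.
-/

noncomputable section

open scoped InnerProductSpace ComplexConjugate BigOperators

namespace Literature.MathematicalPhysics.QuantumFieldTheory.Balaban1983to89.B9Eq3119DeltaPiTowerReality

open B4Sect5Torus (TSite)
open B9SectCLatticeCarrier (Bond)
open B9Eq311L2Pairing (WL2)
open B9Eq311TracePairing (starW realConj btrans)
open B11Eq103H1Complex (SiteL2K BondL2K laplaceALatticeK)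
open B9Eq310HessianOperator (adTransportW hessOp)
open B9Eq310HessianHermitian (hessOp_isSymmetric_of_trace)
open B9Eq315QTower (towerP UlevOf)
open B9Eq315QTorus (perCfg cornerSite)
open B7Prop1Explicit (U1 Wcx boxVec)
open B9Eq326OperatorTower (QkW RofUk)
open B9Eq324DeltaPrimeATower (laplacePrimeAk GpOfUk)
open B9Eq3119DeltaPiCarrier (deltaPi)
open B9Eq3119InvariantExtension (invariantExtension_isSymmetric)
open B9Eq3119DeltaPiTower (piOfUk deltaPiOfUk laplaceAkPi laplaceAkPiHol laplaceAkPi_isSymmetric)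
open B9Eq3119DeltaPiReality (realConj_eq_self_iff real_comp real_id real_sub covDerivL2K_starW covDivL2K_starW)
open B9Eq326OperatorTowerReality (RofUk_starW GpOfUk_starW)

variable {d : ℕ} (L : ℕ) [NeZero L] (m : Fin d → ℕ) [∀ i, NeZero (m i)] (n : ℕ)
  {𝔸 : Type*} [NormedRing 𝔸] [NormedAlgebra ℂ 𝔸] [CompleteSpace 𝔸] [NormOneClass 𝔸] [StarRing 𝔸] [StarModule ℂ 𝔸]
  {W : Type*} [NormedAddCommGroup W] [InnerProductSpace ℂ W] [FiniteDimensional ℂ W] (φ : W ≃ₗ[ℂ] 𝔸) {c₀ : ℝ} [Fact (0 < c₀)]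
  (τ : 𝔸 →ₗ[ℂ] ℂ) (η : ℝ) {U : Bond d (towerP L m (n + 1)) → 𝔸ˣ}
  (hUlev : ∀ (j : ℕ) (b : Bond d (towerP L m (j + 1))), star (UlevOf L m (n + 1) U j b : 𝔸) = ((UlevOf L m (n + 1) U j b)⁻¹ : 𝔸ˣ))
  (hU : ∀ b, star (U b : 𝔸) = ((U b)⁻¹ : 𝔸ˣ))
  (hφ : ∀ X Y : 𝔸, ⟪φ.symm X, φ.symm Y⟫_ℂ = τ (star X * Y)) (hτ₁ : ∀ X : 𝔸, τ (star X) = conj (τ X)) (hτ₂ : ∀ X Y : 𝔸, τ (X * Y) = τ (Y * X))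

/-! ## §1 `π_k(U)` is real at a unitary tower; `π_kᵗ = π_k†` -/

include hUlev hU hφ hτ₁ hτ₂ in
omit [NormOneClass 𝔸] in
/-- **Print's `π_k(U) = 1 − D_U G′ R_k(U) D*_U` IS REAL** at a unitary tower, for any REAL Green's-function letter `G′`.
[cite: Balaban1985BackgroundPropagators, (3.119) p.419, (3.21) p.394] -/
theorem piOfUk_starW {Gp : SiteL2K ℂ d (towerP L m (n + 1)) c₀ W →ₗ[ℂ] SiteL2K ℂ d (towerP L m (n + 1)) c₀ W}
    (hGp : ∀ f, Gp (starW φ f) = starW φ (Gp f)) (A : BondL2K ℂ d (towerP L m (n + 1)) c₀ W) :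
    piOfUk L m n φ η U Gp (starW φ A) = starW φ (piOfUk L m n φ η U Gp A) := by
  rw [piOfUk]
  exact real_sub φ (real_id φ) (real_comp φ (covDerivL2K_starW L (towerP L m n) φ η hU)
    (real_comp φ hGp (real_comp φ (RofUk_starW L φ m n η hUlev hU τ hφ hτ₁ hτ₂) (covDivL2K_starW L (towerP L m n) φ η hU)))) A

include hUlev hU hφ hτ₁ hτ₂ in
omit [NormOneClass 𝔸] in
/-- **`π_kᵗ = π_k†`** — bilinear transpose = Hilbert adjoint at a unitary tower (real `G′`). [cite: Balaban1985BackgroundPropagators, (3.119) p.419] -/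
theorem btrans_piOfUk_eq_adjoint {Gp : SiteL2K ℂ d (towerP L m (n + 1)) c₀ W →ₗ[ℂ] SiteL2K ℂ d (towerP L m (n + 1)) c₀ W}
    (hGp : ∀ f, Gp (starW φ f) = starW φ (Gp f)) :
    btrans φ (piOfUk L m n φ η U Gp) = LinearMap.adjoint (piOfUk L m n φ η U Gp) := by
  show LinearMap.adjoint (realConj φ (piOfUk L m n φ η U Gp)) = _
  rw [(realConj_eq_self_iff φ _).2 (piOfUk_starW L m n φ τ η hUlev hU hφ hτ₁ hτ₂ hGp)]

/-! ## §2 The bilinear `Δ_{π,k}` IS the adjoint sandwich; the two `Δ₁`-slots agree at the unitary centre -/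

include hUlev hU hφ hτ₁ hτ₂ in
omit [NormOneClass 𝔸] in
/-- **`Δ_{π,k}(U) = π_kᵗ Δ^η(U) π_k` IS `π_k† ∘ Δ^η(U) ∘ π_k`** at a unitary tower (real `G′`). [cite: Balaban1985BackgroundPropagators, (3.119) p.419] -/
theorem deltaPiOfUk_eq_adjoint_form {Gp : SiteL2K ℂ d (towerP L m (n + 1)) c₀ W →ₗ[ℂ] SiteL2K ℂ d (towerP L m (n + 1)) c₀ W}
    (hGp : ∀ f, Gp (starW φ f) = starW φ (Gp f)) :
    deltaPiOfUk L m n φ τ η U Gp = LinearMap.adjoint (piOfUk L m n φ η U Gp) ∘ₗ hessOp φ η U τ ∘ₗ piOfUk L m n φ η U Gp := by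
  rw [deltaPiOfUk, deltaPi, btrans_piOfUk_eq_adjoint L m n φ τ η hUlev hU hφ hτ₁ hτ₂ hGp]

variable {c₁ : ℝ} [Fact (0 < c₁)] (a' : ℝ)
  (hpos' : ∀ x : SiteL2K ℂ d (towerP L m (n + 1)) c₀ W, x ≠ 0 → 0 < RCLike.re ⟪x, laplacePrimeAk L m n φ η U a' (c₁ := c₁) x⟫_ℂ)

include hUlev hU hφ hτ₁ hτ₂ in
omit [NormOneClass 𝔸] in
/-- … at print's own `G′_k = (Δ′_{a′,k}(U))⁻¹` (real by `B9Eq326OperatorTowerReality.GpOfUk_starW`; `hpos′` displayed). [cite: Balaban1985BackgroundPropagators, (3.119) p.419, (3.25) p.394] -/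
theorem deltaPiOfUk_GpOfUk_eq_adjoint_form :
    deltaPiOfUk L m n φ τ η U (GpOfUk L m n φ η U a' hpos') =
      LinearMap.adjoint (piOfUk L m n φ η U (GpOfUk L m n φ η U a' hpos')) ∘ₗ hessOp φ η U τ ∘ₗ piOfUk L m n φ η U (GpOfUk L m n φ η U a' hpos') :=
  deltaPiOfUk_eq_adjoint_form L m n φ τ η hUlev hU hφ hτ₁ hτ₂ (GpOfUk_starW L φ m n η hUlev hU τ hφ hτ₁ hτ₂ a' hpos')

variable (hL : 1 ≤ L) (αU : ℕ → ℝ) (hα1 : ∀ j, αU j ≤ 1 / 64)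
  (hU1 : ∀ (j : ℕ) (x : B7Prop1Explicit.Site d) (κ : Fin d), perCfg (towerP L m (j + 1)) (UlevOf L m (n + 1) U j) x κ ∈ U1 𝔸)
  (hreg : ∀ (j : ℕ) (y : TSite d (towerP L m j)) (κ : Fin d) (r : Fin d → Fin L),
    ‖((Wcx L (perCfg (towerP L m (j + 1)) (UlevOf L m (n + 1) U j)) (cornerSite L y) κ (boxVec L r) : 𝔸ˣ) : 𝔸) - 1‖ ≤ αU j)

include hUlev hU hφ hτ₁ hτ₂ in
/-- **THE IDENTIFICATION OF THE TWO `Δ_π` SLOTS AT THE UNITARY CENTRE**: print's operator (3.122) as typed by the OWNER with the ADJOINT sandwich in its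
`Δ₁`-slot (`laplaceAkPi`) EQUALS the same assembly with the BILINEAR, pair-typed `Δ_{π,k}(U) = deltaPiOfUk … (G′_k)` in the slot — so rows at a fixed unitary
background may use either, and rows along complex background families use the bilinear one (t4-ne9-idea-1 g99 J-Δπ-hol). [cite: Balaban1985BackgroundPropagators, (3.122) p.420, (3.119) p.419] -/
theorem laplaceAkPi_eq_bilinear_slot (a : ℝ) :
    laplaceAkPi L m n φ τ η U a' hpos' hL αU hα1 hU1 hreg (c₁ := c₁) a =
      laplaceALatticeK ((η : ℂ))⁻¹ (adTransportW φ U) (adTransportW φ fun b => (U b)⁻¹)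
        (deltaPiOfUk L m n φ τ η U (GpOfUk L m n φ η U a' hpos')) (RofUk L m n φ η U) (QkW L m n φ U hL αU hα1 hU1 hreg (c₁ := c₁)) a := by
  rw [laplaceAkPi, deltaPiOfUk_GpOfUk_eq_adjoint_form L m n φ τ η hUlev hU hφ hτ₁ hτ₂ a' hpos']

include hUlev hU hφ hτ₁ hτ₂ in
/-- **… i.e. `Δ̃_{a,k}(U) = Δ̃ʰ_{a,k}(U)`**: the OWNER's adjoint-slot operator `laplaceAkPi` and the pair-typed `laplaceAkPiHol` (v1.1 §4, «at a unitary background it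
agrees with §3's adjoint slot — the k-level reality lemma is NOT ported here») COINCIDE at a unitary tower — ported here. [cite: Balaban1985BackgroundPropagators, (3.122) p.420, (3.119) p.419] -/
theorem laplaceAkPi_eq_laplaceAkPiHol (a : ℝ) :
    laplaceAkPi L m n φ τ η U a' hpos' hL αU hα1 hU1 hreg (c₁ := c₁) a = laplaceAkPiHol L m n φ τ η U a' hpos' hL αU hα1 hU1 hreg (c₁ := c₁) a := by
  rw [laplaceAkPiHol]
  exact laplaceAkPi_eq_bilinear_slot L m n φ τ η hUlev hU hφ hτ₁ hτ₂ a' hpos' hL αU hα1 hU1 hreg a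

include hUlev hU hφ hτ₁ hτ₂ in
/-- **`Δ̃ʰ_{a,k}(U)` IS SYMMETRIC at a unitary tower** (through the identification; the OWNER's `laplaceAkPi_isSymmetric`). [cite: Balaban1985BackgroundPropagators, (3.122) p.420, p.392] -/
theorem laplaceAkPiHol_isSymmetric (a : ℝ) : (laplaceAkPiHol L m n φ τ η U a' hpos' hL αU hα1 hU1 hreg (c₁ := c₁) a).IsSymmetric := by
  rw [← laplaceAkPi_eq_laplaceAkPiHol L m n φ τ η hUlev hU hφ hτ₁ hτ₂ a' hpos' hL αU hα1 hU1 hreg a]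
  exact laplaceAkPi_isSymmetric L m n φ τ η U a' hpos' hL αU hα1 hU1 hreg hU hτ₁ hτ₂ hφ a

/-! ## §3 `Δ_{π,k}(U)` is symmetric -/

include hUlev hU hφ hτ₁ hτ₂ in
omit [NormOneClass 𝔸] in
/-- **`Δ_{π,k}(U)` IS A SYMMETRIC (HERMITIAN) OPERATOR** at a unitary tower with a `*`-trace (real `G′`): print p. 392's «hermitian operator» for the
extended form (3.119) at `k` levels. [cite: Balaban1985BackgroundPropagators, p.392, (3.119) p.419] -/
theorem deltaPiOfUk_isSymmetric {Gp : SiteL2K ℂ d (towerP L m (n + 1)) c₀ W →ₗ[ℂ] SiteL2K ℂ d (towerP L m (n + 1)) c₀ W}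
    (hGp : ∀ f, Gp (starW φ f) = starW φ (Gp f)) : (deltaPiOfUk L m n φ τ η U Gp).IsSymmetric := by
  rw [deltaPiOfUk_eq_adjoint_form L m n φ τ η hUlev hU hφ hτ₁ hτ₂ hGp]
  exact invariantExtension_isSymmetric _ (hessOp_isSymmetric_of_trace φ τ hτ₁ hτ₂ η hU hφ)

include hUlev hU hφ hτ₁ hτ₂ in
omit [NormOneClass 𝔸] in
/-- … at print's own `G′_k`: symmetric with no reality letter (`hpos′` displayed). [cite: Balaban1985BackgroundPropagators, p.392, (3.119) p.419, (3.25) p.394] -/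
theorem deltaPiOfUk_GpOfUk_isSymmetric : (deltaPiOfUk L m n φ τ η U (GpOfUk L m n φ η U a' hpos')).IsSymmetric :=
  deltaPiOfUk_isSymmetric L m n φ τ η hUlev hU hφ hτ₁ hτ₂ (GpOfUk_starW L φ m n η hUlev hU τ hφ hτ₁ hτ₂ a' hpos')

end Literature.MathematicalPhysics.QuantumFieldTheory.Balaban1983to89.B9Eq3119DeltaPiTowerReality

end
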